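import Summits.HodgeConjecture.HodgeConjecture.Theorems.R90S6EllipticOrbitalDisplacementCount   -- ★ A1 p863730 §1 `orbitalIntegral_indicator_doubleCoset_eq_mul_ncard_orbitShell` (any group); brings ★ (J1), ★ λ = 0 `OrbitalIntegralFixedPointCount`, ★ `isOpen_unitaryInt`
import HarnessLib

/-!
# R90 · S6 «Ch. 14.1–14.5 stable trace formula» — CARD A1-H (α) (rows E1.3.5.2.5 ∕ E1.3.7.1, H-side): ORBITAL INTEGRALS OF THE HECKE BASIS OF A UNITARY GROUP AT
# HYPERSPECIAL LEVEL AS SHELL COUNTS IN `U ⧸ K₀` — COSET CURRENCY, rank one `U(2)_w ≅ U(1,1)` by name (`Theorems/R90S6EllipticOrbitalShellCountU2.lean`)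

Dealer R90-C14-plan (g2), CARD A1-H ruling (α) 2026-09-05T00:50:12Z.  `K` a valued field (`Valued K ℤᵐ⁰`), `σ : K →+* K`, `H` ANY hermitian matrix of size `N`,
`U = U(σ, H)(K) = unitaryGroupOfForm σ H` (topological group), `K₀ = unitaryInt σ H = U ∩ GL_N(𝒪)` (OPEN, ★ `isOpen_unitaryInt`), `s ∈ U` arbitrary (for the Hecke basis:
`s = tᵏ`, `t` the split torus generator — at `N = 2` p03's binder `t` with matrix `diag(ϖ, ϖ⁻¹)`, ★ `R90S6MacdonaldRankOneU2`; at `N = 3` `hd.torusGen`), `γ ∈ U` with COMPACT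
centraliser `C` carrying the Haar measure `ρ` of mass one, `ν` a Haar measure on `U`, `φ_s = 1_{K₀ s K₀} = (DoubleCoset.doubleCoset s K₀ K₀).indicator 1`.

* §1 (any `N`, `H`) **`orbitalIntegral_unitaryShell_eq_mul_ncard_orbitShell`**: `O_γ^{ν∕ρ}(1_{K₀ s K₀}) = ν(K₀) · #{q ∈ U ⧸ K₀ : (q.out⁻¹ γ q.out) K₀ ∈ K₀ · sK₀}` (★ A1 §1 with
  `hK := isOpen_unitaryInt`); unit-normalised **`…_eq_natCard_orbitShell`** (`ν(K₀) = 1`); the trivial shell **`doubleCoset_one_eq`** (`K₀ 1 K₀ = K₀`) and the `λ = 0` line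
  **`orbitalIntegral_unitaryShell_one_eq_mul_ncard_fixedPoints`**: `O_γ(1_{K₀ s⁰ K₀}) = ν(K₀) · #{q : γ • q = q}` (★ `orbitalIntegral_indicator_quotientMeasure_eq_mul_ncard_fixedPoints`).
* §2 (`N = 2`, `H = J₂ = antidiag(1,1)`, p03's binders `(t : U(σ, J₂))`, `φ′_k = 1_{K₀ tᵏ K₀}`) the BY-NAME heads for the `U(1,1)_w`-factor of `H_w = U(2) × U(1)`:
  **`orbitalIntegral_doubleCosetShell_eq_mul_ncard_orbitShell_two`**, **`…_eq_natCard_orbitShell_two`**, **`orbitalIntegral_doubleCosetShell_zero_eq_mul_ncard_fixedPoints_two`**.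

The TREE READING («`#shell_k = #{x self-dual : d(x, γ·x) = 2k}` on the `(q_v+1)`-regular tree ★ `HermitianLatticeTree*` ∕ `isTree_latticeTree`, and the closed form
`q_v^{k−1} · #{d = 2}` by ★ W8-f `ncard_displaced_eq_of_regular`») is the sequel `Theorems/R90S6EllipticOrbitalDisplacementU2.lean` (A1-H (ii)(iii)); this file is its
coset half, valid for every `N` and every place.

Cell `hodgecm-mathlib`, crux H413 (`stmt-HodgeConjecture-24833`), route of record `HCCMUnconditional`; programme R90-TF (brief `director/R90-BRIEF.v2.md` 1f40d54518340a35),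
section S6 (base `R90-C14`), seat R90-C14-p01 (g2).  Lane `--kind proof --supports stmt-HodgeConjecture-24833 --as helper`; THEOREMS ONLY (no definition, no instance, no notation,
no named fact, no kit, no `sorry`); imports ★ A1 `Theorems/R90S6EllipticOrbitalDisplacementCount` + HarnessLib.
HONEST LABEL: measure∕coset bookkeeping, count-neutral until E1.3.5.2.5 ∕ E1.3.7.1 consume it; the H-side engine stays OPEN until the tree reading lands; proves no printed global
statement, discharges no citation; HC_CM is proved only modulo the 7 printed citations (2 remaining named inputs: hLiu418 = stmt-HodgeConjecture-24832, h413 = stmt-HodgeConjecture-24833)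
until rung 0 closes.

## References
* [Rogawski1990] J. D. Rogawski, *Automorphic Representations of Unitary Groups in Three Variables*, Ann. of Math. Stud. 123 (1990): §4.9 pp. 54–55 (`Φ(γ, f)` as a sum over
  `G_γ\G∕K`), §4.11 pp. 59–60 (the `U(2)` pairs).
* [Kottwitz1986BaseChangeUnits] R. E. Kottwitz, *Base change for unit elements of Hecke algebras*, Compositio Math. 60 (1986): §1 pp. 240–242.
* [LabesseLanglands1979] J.-P. Labesse, R. P. Langlands, *L-indistinguishability for SL(2)*, Canad. J. Math. 31 (1979): §§2–3 (rank-one orbital integrals as counts on the tree).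
* [Laumon1995] G. Laumon, *Cohomology of Drinfeld Modular Varieties*, Part I (1996): Lemma (5.3.2) p. 136.
-/

set_option autoImplicit false
-- the mandated namespace repeats the single-problem summit's segment (`HodgeConjecture.HodgeConjecture`)
set_option linter.dupNamespace false

noncomputable section

open MeasureTheory Measure Topology Set Function
open scoped ENNReal NNReal Pointwise Valued WithZero Matrix MatrixGroups
open MulAction
open Literature.MeasureTheory.Group Literature.NumberTheory.Automorphic Literature.NumberTheory.Automorphic.HermitianLattice

namespace Summit.HodgeConjecture.HodgeConjecture.R90.S6

/-! ## §0 The trivial shell `K 1 K = K` -/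

section Trivial

variable {G : Type*} [Group G] (L : Subgroup G)

/-- `K · {1} · K = K` for a subgroup `K` (the `λ = 0` shell is the level itself). [cite: Rogawski1990, §4.9 p. 54] -/
theorem doubleCoset_one_eq : DoubleCoset.doubleCoset (1 : G) (L : Set G) L = L := by
  ext g
  rw [DoubleCoset.mem_doubleCoset, SetLike.mem_coe]
  constructor
  · rintro ⟨x, hx, y, hy, rfl⟩
    rw [mul_one]
    exact L.mul_mem hx hy
  · intro hg
    exact ⟨g, hg, 1, L.one_mem, by group⟩

end Trivial

/-! ## §1 Any unitary group `U(σ, H)` at hyperspecial-type level `K₀ = U ∩ GL_N(𝒪)`: shells of `U ⧸ K₀` -/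

section Unitary

variable {K : Type*} [Field K] [Valued K ℤᵐ⁰] {σ : K →+* K} {N : ℕ} (H : Matrix (Fin N) (Fin N) K)
  [LocallyCompactSpace (unitaryGroupOfForm σ H)] [SecondCountableTopology (unitaryGroupOfForm σ H)]
  [MeasurableSpace (unitaryGroupOfForm σ H)] [BorelSpace (unitaryGroupOfForm σ H)]
  (s γ : unitaryGroupOfForm σ H)
  [MeasurableSpace (unitaryGroupOfForm σ H ⧸ Subgroup.centralizer ({γ} : Set (unitaryGroupOfForm σ H)))]
  [BorelSpace (unitaryGroupOfForm σ H ⧸ Subgroup.centralizer ({γ} : Set (unitaryGroupOfForm σ H)))]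
  [hC : IsClosed ((Subgroup.centralizer ({γ} : Set (unitaryGroupOfForm σ H)) : Subgroup (unitaryGroupOfForm σ H)) : Set (unitaryGroupOfForm σ H))]
  (ρ : Measure (Subgroup.centralizer ({γ} : Set (unitaryGroupOfForm σ H)))) [ρ.IsMulLeftInvariant]
  [IsFiniteMeasureOnCompacts ρ] [ρ.IsOpenPosMeasure] [ρ.IsInvInvariant] [SFinite ρ]
  (ν : Measure (unitaryGroupOfForm σ H)) [IsHaarMeasure ν] [ν.IsMulRightInvariant]
  [CompactSpace (Subgroup.centralizer ({γ} : Set (unitaryGroupOfForm σ H)))]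
  (hρ : ρ Set.univ = 1)
include hρ

/-- **`O_γ^{ν∕ρ}(1_{K₀ s K₀}) = ν(K₀) · #{q ∈ U ⧸ K₀ : (q.out⁻¹ γ q.out) K₀ ∈ K₀ · sK₀}`** for ANY unitary group `U = U(σ, H)(K)`, `K₀ = unitaryInt σ H` (open, ★ `isOpen_unitaryInt`),
`s ∈ U`, and `γ ∈ U` with COMPACT centraliser of `ρ`-mass one — provided the shell is finite (★ A1 §1 `orbitalIntegral_indicator_doubleCoset_eq_mul_ncard_orbitShell`).  The shell is
written in the ORBIT currency of ★ `heckeOperator` ∕ ★ (J2). [cite: Rogawski1990, §4.9 pp. 54–55] [cite: Laumon1995, Lemma (5.3.2) p. 136] -/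
theorem orbitalIntegral_unitaryShell_eq_mul_ncard_orbitShell
    (hfin : {q : unitaryGroupOfForm σ H ⧸ unitaryInt σ H |
        ((q.out⁻¹ * γ * q.out : unitaryGroupOfForm σ H) : unitaryGroupOfForm σ H ⧸ unitaryInt σ H) ∈
          MulAction.orbit (unitaryInt σ H) ((s : unitaryGroupOfForm σ H) : unitaryGroupOfForm σ H ⧸ unitaryInt σ H)}.Finite) :
    orbitalIntegral γ ((DoubleCoset.doubleCoset s (unitaryInt σ H : Set _) (unitaryInt σ H)).indicator (1 : unitaryGroupOfForm σ H → ℝ))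
        (quotientMeasure (Subgroup.centralizer ({γ} : Set (unitaryGroupOfForm σ H))) ρ hC ν) =
      (ν (unitaryInt σ H)).toReal *
        ({q : unitaryGroupOfForm σ H ⧸ unitaryInt σ H |
            ((q.out⁻¹ * γ * q.out : unitaryGroupOfForm σ H) : unitaryGroupOfForm σ H ⧸ unitaryInt σ H) ∈
              MulAction.orbit (unitaryInt σ H) ((s : unitaryGroupOfForm σ H) : unitaryGroupOfForm σ H ⧸ unitaryInt σ H)}.ncard : ℝ) :=
  orbitalIntegral_indicator_doubleCoset_eq_mul_ncard_orbitShell (unitaryInt σ H) s γ ρ ν (isOpen_unitaryInt σ H) hρ hfin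

/-- **Unit normalisation**: with `ν(K₀) = 1` (and `ρ(C) = 1`), `O_γ(1_{K₀ s K₀}) = #{q ∈ U ⧸ K₀ : (q.out⁻¹ γ q.out) K₀ ∈ K₀ · sK₀}` as a natural number (`Nat.card`).
[cite: Rogawski1990, §4.9 pp. 54–55] -/
theorem orbitalIntegral_unitaryShell_eq_natCard_orbitShell (hν : ν (unitaryInt σ H) = 1)
    (hfin : {q : unitaryGroupOfForm σ H ⧸ unitaryInt σ H |
        ((q.out⁻¹ * γ * q.out : unitaryGroupOfForm σ H) : unitaryGroupOfForm σ H ⧸ unitaryInt σ H) ∈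
          MulAction.orbit (unitaryInt σ H) ((s : unitaryGroupOfForm σ H) : unitaryGroupOfForm σ H ⧸ unitaryInt σ H)}.Finite) :
    orbitalIntegral γ ((DoubleCoset.doubleCoset s (unitaryInt σ H : Set _) (unitaryInt σ H)).indicator (1 : unitaryGroupOfForm σ H → ℝ))
        (quotientMeasure (Subgroup.centralizer ({γ} : Set (unitaryGroupOfForm σ H))) ρ hC ν) =
      (Nat.card {q : unitaryGroupOfForm σ H ⧸ unitaryInt σ H |
          ((q.out⁻¹ * γ * q.out : unitaryGroupOfForm σ H) : unitaryGroupOfForm σ H ⧸ unitaryInt σ H) ∈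
            MulAction.orbit (unitaryInt σ H) ((s : unitaryGroupOfForm σ H) : unitaryGroupOfForm σ H ⧸ unitaryInt σ H)} : ℝ) := by
  rw [orbitalIntegral_unitaryShell_eq_mul_ncard_orbitShell H s γ ρ ν hρ hfin, hν, ENNReal.toReal_one, one_mul, Nat.card_coe_set_eq]

/-- **The `λ = 0` shell** (`s⁰ = 1`, `K₀ 1 K₀ = K₀`): `O_γ^{ν∕ρ}(1_{K₀ s⁰ K₀}) = ν(K₀) · #{q ∈ U ⧸ K₀ : γ • q = q}` — the fixed-coset count of ★ `OrbitalIntegralFixedPointCount`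
(`orbitalIntegral_indicator_quotientMeasure_eq_mul_ncard_fixedPoints`), by name in the shell family. [cite: Rogawski1990, §4.9 p. 54] [cite: Kottwitz1986BaseChangeUnits, §1 pp. 240–242] -/
theorem orbitalIntegral_unitaryShell_one_eq_mul_ncard_fixedPoints
    (hfin : {q : unitaryGroupOfForm σ H ⧸ unitaryInt σ H | γ • q = q}.Finite) :
    orbitalIntegral γ ((DoubleCoset.doubleCoset (s ^ 0) (unitaryInt σ H : Set _) (unitaryInt σ H)).indicator (1 : unitaryGroupOfForm σ H → ℝ))
        (quotientMeasure (Subgroup.centralizer ({γ} : Set (unitaryGroupOfForm σ H))) ρ hC ν) =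
      (ν (unitaryInt σ H)).toReal * ({q : unitaryGroupOfForm σ H ⧸ unitaryInt σ H | γ • q = q}.ncard : ℝ) := by
  rw [pow_zero, doubleCoset_one_eq]
  exact orbitalIntegral_indicator_quotientMeasure_eq_mul_ncard_fixedPoints γ (unitaryInt σ H) ρ ν (isOpen_unitaryInt σ H) hρ hfin

end Unitary

/-! ## §2 `N = 2`: the `U(1,1)_w`-factor of `H_w = U(2) × U(1)` by name (p03's binders) -/

section Two

variable {K : Type*} [Field K] [Valued K ℤᵐ⁰] {σ : K →+* K}
  [LocallyCompactSpace (unitaryGroupOfForm σ ((StdForm.antidiagonal 2).over K))]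
  [SecondCountableTopology (unitaryGroupOfForm σ ((StdForm.antidiagonal 2).over K))]
  [MeasurableSpace (unitaryGroupOfForm σ ((StdForm.antidiagonal 2).over K))] [BorelSpace (unitaryGroupOfForm σ ((StdForm.antidiagonal 2).over K))]
  (γ t : unitaryGroupOfForm σ ((StdForm.antidiagonal 2).over K))
  [MeasurableSpace (unitaryGroupOfForm σ ((StdForm.antidiagonal 2).over K) ⧸
    Subgroup.centralizer ({γ} : Set (unitaryGroupOfForm σ ((StdForm.antidiagonal 2).over K))))]
  [BorelSpace (unitaryGroupOfForm σ ((StdForm.antidiagonal 2).over K) ⧸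
    Subgroup.centralizer ({γ} : Set (unitaryGroupOfForm σ ((StdForm.antidiagonal 2).over K))))]
  [hC : IsClosed ((Subgroup.centralizer ({γ} : Set (unitaryGroupOfForm σ ((StdForm.antidiagonal 2).over K))) :
    Subgroup (unitaryGroupOfForm σ ((StdForm.antidiagonal 2).over K))) : Set (unitaryGroupOfForm σ ((StdForm.antidiagonal 2).over K)))]
  (ρ : Measure (Subgroup.centralizer ({γ} : Set (unitaryGroupOfForm σ ((StdForm.antidiagonal 2).over K)))))
  [ρ.IsMulLeftInvariant] [IsFiniteMeasureOnCompacts ρ] [ρ.IsOpenPosMeasure] [ρ.IsInvInvariant] [SFinite ρ]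
  (ν : Measure (unitaryGroupOfForm σ ((StdForm.antidiagonal 2).over K))) [IsHaarMeasure ν] [ν.IsMulRightInvariant]
  [CompactSpace (Subgroup.centralizer ({γ} : Set (unitaryGroupOfForm σ ((StdForm.antidiagonal 2).over K))))]
  (hρ : ρ Set.univ = 1)
include hρ

/-- **A1-H (α), `U(2)_w ≅ U(1,1)` COSET FORM**: for `γ ∈ U(σ, J₂)(K)` with compact centraliser (mass-one `ρ`), any `t ∈ U(σ, J₂)` (p03's binder: matrix `diag(ϖ, ϖ⁻¹)`) and
`k ∈ ℕ`, `O_γ^{ν∕ρ}(φ′_k) = ν(K₀) · #{q ∈ U₂ ⧸ K₀ : (q.out⁻¹ γ q.out) K₀ ∈ K₀ · tᵏK₀}` (`φ′_k = 1_{K₀ tᵏ K₀}`; finitely many such cosets).  On the `(q_v+1)`-regular tree of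
`U(1,1)_w` (★ `isTree_latticeTree`) the right side reads `ν(K₀) · #{x self-dual : d(x, γ·x) = 2k}` — sequel file. [cite: Rogawski1990, §4.9 pp. 54–55] [cite: Rogawski1990, §4.11 pp. 59–60]
[cite: LabesseLanglands1979, §§2–3] -/
theorem orbitalIntegral_doubleCosetShell_eq_mul_ncard_orbitShell_two (k : ℕ)
    (hfin : {q : unitaryGroupOfForm σ ((StdForm.antidiagonal 2).over K) ⧸ unitaryInt σ ((StdForm.antidiagonal 2).over K) |
        ((q.out⁻¹ * γ * q.out : unitaryGroupOfForm σ ((StdForm.antidiagonal 2).over K)) :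
            unitaryGroupOfForm σ ((StdForm.antidiagonal 2).over K) ⧸ unitaryInt σ ((StdForm.antidiagonal 2).over K)) ∈
          MulAction.orbit (unitaryInt σ ((StdForm.antidiagonal 2).over K))
            ((t ^ k : unitaryGroupOfForm σ ((StdForm.antidiagonal 2).over K)) :
              unitaryGroupOfForm σ ((StdForm.antidiagonal 2).over K) ⧸ unitaryInt σ ((StdForm.antidiagonal 2).over K))}.Finite) :
    orbitalIntegral γ
        ((DoubleCoset.doubleCoset (t ^ k) (unitaryInt σ ((StdForm.antidiagonal 2).over K) : Set _)
            (unitaryInt σ ((StdForm.antidiagonal 2).over K))).indicator (1 : unitaryGroupOfForm σ ((StdForm.antidiagonal 2).over K) → ℝ))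
        (quotientMeasure (Subgroup.centralizer ({γ} : Set (unitaryGroupOfForm σ ((StdForm.antidiagonal 2).over K)))) ρ hC ν) =
      (ν (unitaryInt σ ((StdForm.antidiagonal 2).over K))).toReal *
        ({q : unitaryGroupOfForm σ ((StdForm.antidiagonal 2).over K) ⧸ unitaryInt σ ((StdForm.antidiagonal 2).over K) |
            ((q.out⁻¹ * γ * q.out : unitaryGroupOfForm σ ((StdForm.antidiagonal 2).over K)) :
                unitaryGroupOfForm σ ((StdForm.antidiagonal 2).over K) ⧸ unitaryInt σ ((StdForm.antidiagonal 2).over K)) ∈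
              MulAction.orbit (unitaryInt σ ((StdForm.antidiagonal 2).over K))
                ((t ^ k : unitaryGroupOfForm σ ((StdForm.antidiagonal 2).over K)) :
                  unitaryGroupOfForm σ ((StdForm.antidiagonal 2).over K) ⧸ unitaryInt σ ((StdForm.antidiagonal 2).over K))}.ncard : ℝ) :=
  orbitalIntegral_unitaryShell_eq_mul_ncard_orbitShell ((StdForm.antidiagonal 2).over K) (t ^ k) γ ρ ν hρ hfin

/-- **A1-H (α), unit normalisation**: with `ν(K₀) = 1`, `O_γ(φ′_k) = #{q ∈ U₂ ⧸ K₀ : (q.out⁻¹ γ q.out) K₀ ∈ K₀ · tᵏK₀}` (`Nat.card`). [cite: Rogawski1990, §4.9 pp. 54–55]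
[cite: LabesseLanglands1979, §§2–3] -/
theorem orbitalIntegral_doubleCosetShell_eq_natCard_orbitShell_two (hν : ν (unitaryInt σ ((StdForm.antidiagonal 2).over K)) = 1) (k : ℕ)
    (hfin : {q : unitaryGroupOfForm σ ((StdForm.antidiagonal 2).over K) ⧸ unitaryInt σ ((StdForm.antidiagonal 2).over K) |
        ((q.out⁻¹ * γ * q.out : unitaryGroupOfForm σ ((StdForm.antidiagonal 2).over K)) :
            unitaryGroupOfForm σ ((StdForm.antidiagonal 2).over K) ⧸ unitaryInt σ ((StdForm.antidiagonal 2).over K)) ∈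
          MulAction.orbit (unitaryInt σ ((StdForm.antidiagonal 2).over K))
            ((t ^ k : unitaryGroupOfForm σ ((StdForm.antidiagonal 2).over K)) :
              unitaryGroupOfForm σ ((StdForm.antidiagonal 2).over K) ⧸ unitaryInt σ ((StdForm.antidiagonal 2).over K))}.Finite) :
    orbitalIntegral γ
        ((DoubleCoset.doubleCoset (t ^ k) (unitaryInt σ ((StdForm.antidiagonal 2).over K) : Set _)
            (unitaryInt σ ((StdForm.antidiagonal 2).over K))).indicator (1 : unitaryGroupOfForm σ ((StdForm.antidiagonal 2).over K) → ℝ))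
        (quotientMeasure (Subgroup.centralizer ({γ} : Set (unitaryGroupOfForm σ ((StdForm.antidiagonal 2).over K)))) ρ hC ν) =
      (Nat.card {q : unitaryGroupOfForm σ ((StdForm.antidiagonal 2).over K) ⧸ unitaryInt σ ((StdForm.antidiagonal 2).over K) |
          ((q.out⁻¹ * γ * q.out : unitaryGroupOfForm σ ((StdForm.antidiagonal 2).over K)) :
              unitaryGroupOfForm σ ((StdForm.antidiagonal 2).over K) ⧸ unitaryInt σ ((StdForm.antidiagonal 2).over K)) ∈
            MulAction.orbit (unitaryInt σ ((StdForm.antidiagonal 2).over K))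
              ((t ^ k : unitaryGroupOfForm σ ((StdForm.antidiagonal 2).over K)) :
                unitaryGroupOfForm σ ((StdForm.antidiagonal 2).over K) ⧸ unitaryInt σ ((StdForm.antidiagonal 2).over K))} : ℝ) :=
  orbitalIntegral_unitaryShell_eq_natCard_orbitShell ((StdForm.antidiagonal 2).over K) (t ^ k) γ ρ ν hρ hν hfin

/-- **A1-H (α), the unit `φ′_0 = 1_{K₀}`**: `O_γ^{ν∕ρ}(1_{K₀ t⁰ K₀}) = ν(K₀) · #{q ∈ U₂ ⧸ K₀ : γ • q = q}` — the fixed hyperspecial cosets (= fixed self-dual vertices of the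
`U(1,1)` tree, ★ `HermitianLatticeTreeFixedDictionary.exists_equiv_fixedBy_fixed_selfDual_apply`). [cite: Rogawski1990, §4.9 p. 54] [cite: Kottwitz1986BaseChangeUnits, §1 pp. 240–242] -/
theorem orbitalIntegral_doubleCosetShell_zero_eq_mul_ncard_fixedPoints_two
    (hfin : {q : unitaryGroupOfForm σ ((StdForm.antidiagonal 2).over K) ⧸ unitaryInt σ ((StdForm.antidiagonal 2).over K) | γ • q = q}.Finite) :
    orbitalIntegral γ
        ((DoubleCoset.doubleCoset (t ^ 0) (unitaryInt σ ((StdForm.antidiagonal 2).over K) : Set _)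
            (unitaryInt σ ((StdForm.antidiagonal 2).over K))).indicator (1 : unitaryGroupOfForm σ ((StdForm.antidiagonal 2).over K) → ℝ))
        (quotientMeasure (Subgroup.centralizer ({γ} : Set (unitaryGroupOfForm σ ((StdForm.antidiagonal 2).over K)))) ρ hC ν) =
      (ν (unitaryInt σ ((StdForm.antidiagonal 2).over K))).toReal *
        ({q : unitaryGroupOfForm σ ((StdForm.antidiagonal 2).over K) ⧸ unitaryInt σ ((StdForm.antidiagonal 2).over K) | γ • q = q}.ncard : ℝ) :=
  orbitalIntegral_unitaryShell_one_eq_mul_ncard_fixedPoints ((StdForm.antidiagonal 2).over K) t γ ρ ν hρ hfin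

end Two

end Summit.HodgeConjecture.HodgeConjecture.R90.S6

end
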